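import Literature.NumberTheory.EllipticCurves.Kato2004.ZetaClassOnRankLeOneBranch
import Summits.BirchSwinnertonDyer.BirchSwinnertonDyer.Theorems.UniversalToricDescentSigmaEulerMuZero
import HarnessLib

/-!
# Crux `EllipticUnitValueSevenOfGZK` (stmt-BirchSwinnertonDyer-19945), line `kato_perrin_riou_zp` v13, stub (E2)
# `stub_muFreeRealisedFamilySeven`: the μ-FREE CONJUNCT of `Kato2004.HasMuFreeRealisedZetaFamilyBody` is PARAMETER-FREE
# (kernel, every prime `p`; ideator seat bsd-idea-20 g66, crux workfile — REV 1)

Seat `bsd-idea-20` g66 (planner / ideator, crux-level only; kit 0; no proposals; nothing booked; the line of record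
`Lines/kato_perrin_riou_zp.lean` v13 is the pen's and is untouched).  HONEST LABEL: nothing about any elliptic curve is
proved here; crux 19945 stays OPEN; BSD is claimed for no curve.  Every theorem below is KERNEL (no `sorry`, no new
definition, no named fact): `Λ`-algebra in `Λ = ℤ_p⟦T⟧` and `Λ/pΛ = 𝔽_p⟦T⟧`, elementary number theory of Kato's guards, and
the tree's periodicity `ratMinusSymbol_add_intCast` of the minus modular symbol.

WHY THIS FILE.  The v13 partition (pen D920) leaves the rank-4 stub (E2) `stub_muFreeRealisedFamilySeven` UNOWNED; its
conclusion `Kato2004.HasMuFreeRealisedZetaFamily W' 7 K hK I` is `HasRealisedZetaFamilyBody` (REALISATION, §13.14 at the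
member) plus two scalar clauses: `0 ≤ e` and the μ-FREE clause
`¬ ((p : IwasawaAlgebra p) ∣ katoMultiplier p c d₁ n₁ n₂ n₃ n₄ Ψ_c Ψ_{d₁} (A.primeFactors.erase p) a_• ε_• Ψ_•)`
(`ZetaClassOnRankLeOneBranch.lean` §6, l.587–594).  The docstring of `HasMuFreeRealisedZetaFamilyBody` already NAMES the way
out («e.g. `[a/A]⁻_f/q⁻` a `p`-adic unit and `c ≡ d₁ ≡ d′ ≡ 1 (mod A)`: then `M̃ = n₁·cd₁(c − Ψ_c)(d₁ − Ψ_{d₁})·∏_ℓ(…)` has a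
unit coefficient»); this file PROVES it, for every prime `p` and with NO hypothesis on the Dirichlet data `a_ℓ, ε_ℓ`:

* §1 images in `𝔽_p⟦T⟧`: `(1+T)^x ↦ u` has constant coefficient `1` and `u ≠ 1` for `x ≠ 0` (the tree's Lucas-free lemma
  `SigmaEulerMu.not_C_p_dvd_onePlusTPow_sub_one`, any `p`);
* §2 the three factor lemmas in the domain `𝔽_p⟦T⟧`: `d̄ − v ≠ 0`; `c̄·n̄₁ − n̄₂·u ≠ 0` unless `n̄₁ = n̄₂ = 0` (`c̄ ≠ 0`);
  Kato's Euler factor `ℓ̄²w² − ā ℓ̄ w + ε̄ ℓ̄ ≠ 0` for `ℓ̄ ≠ 0` (read constant coefficients twice — NO condition on `ā, ε̄`);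
* §3 **`not_C_p_dvd_katoMultiplier_semidiag`**: in the SEMI-DIAGONAL gauge `n₃ = n₁, n₄ = n₂` (i.e. `d′ = 1`) the four-cusp
  factor is `c d (d − Ψ_d)(c n₁ − n₂ Ψ_c)`, and `p ∤ M̃` as soon as `p ∤ c`, `p ∤ d`, NOT (`p ∣ n₁` and `p ∣ n₂`), the exponents
  of `Ψ_c, Ψ_d, Ψ_ℓ` are `≠ 0` and `p ∤ ℓ` on `E`; the DIAGONAL gauge `n₁ = n₂ = n₃ = n₄ = n` (`c ≡ 1 (mod A)` too) is the case
  `p ∤ n`; natCast currency `¬ (p : Λ) ∣ M̃` and `M̃ ∉ (p) = augIdealP`;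
* §4 exponents from the CYCLOTOMIC tower: `K.IsCyclotomic`, `χ_cyc(σ) = c ∈ ℤ ∖ {±1}` ⟹ `κ(σ) ≠ 0` (a unit of finite order in
  `ℤ` is `±1`), whence the `Ψ`-KEYED theorem **`not_natCast_dvd_katoMultiplier_psi_of_isCyclotomic`** in the letter of the body's
  clause (with `E = A.primeFactors.erase p`, `Ψ_b = IwasawaCharacter.Psi p ℤ_p K σ_b`, `χ_cyc σ_b = b`);
* §5 the SYMBOL SIDE: the minus symbols generate `ℤ·q⁻` ⟹ some `[a/A]⁻ = n·q⁻` with `p ∤ n` (`exists_ratMinusSymbol_not_dvd`);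
  in the gauge `c ≡ 1 (mod A)`, `d′ = 1` the four symbols of the body coincide (`ratMinusSymbol_add_intCast`) and
  `ratCuspFactor f true c d a A 1 = [a/A]⁻·c d (c−1)(d−1)`; **`exists_diagonalGauge`** packages ADMISSIBLE parameters
  `(c, d₁, a, A, d′) = (1 + 6pA, 1 + 6pNA, a, A, 1)` meeting every guard of clause (A3) of the body (`0 < A`, `gcd(c,6pA) = 1`,
  `gcd(d₁,6pN) = 1`, `d₁d′ ≡ 1 (mod A)`, `R⁻ ≠ 0`) together with the four symbol equations at ONE `n` with `p ∤ n`, `p ∤ c`,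
  `p ∤ d₁`, `c, d₁ ∉ {±1}`;
* §6 **`muFree_conjunct_of_diagonalGauge`**: §3 + §4 at these parameters = the μ-free conjunct of the body VERBATIM
  (`katoMultiplier p c d₁ n n n n (Psi … σc) (Psi … σd) (A.primeFactors.erase p) aℓ εℓ (fun ℓ => Psi … (σℓ ℓ))`, ANY `aℓ εℓ`,
  in particular the body's `fun ℓ => W.LFunction ℓ` and `fun ℓ => if ℓ ∣ N then 0 else 1`); and the printed currency
  `dvd_of_dvd_natCast_mul`: `p ∤ M̃ ⟹ Λ/M̃Λ` is `p`-torsion-free (§13.12).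

UPSHOT for (E2) (memo `MuFreeClause-g66.md`): since Kato's construction (Thm. 12.5/13.9–13.12, the tree's `ZetaBody`) accepts
ANY admissible `(c, d₁, a, A, d′)`, the μ-free clause costs nothing: (E2) = REALISATION at the modular-lattice member with the
parameters of `exists_diagonalGauge` ∧ `0 ≤ e`.  The stub docstring's disjunct «a multiplier coefficient divisible by 7» is void.
This supersedes the seat's own constant-coefficient numerics (crux dir `ExistenceConjunct-g57.md` (E2-lemma), `E3primeAudit-g58.md`),
which tested the sufficient condition `7 ∤ M̃(0)` only.  Twin at `p = 2` (different gauge, `𝔽₂`-specific): bsd-2adic's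
`SteinbergFibreAtTwo.not_C_two_dvd_katoMultiplier` (p683151).

References: [Kato2004Asterisque] Thm. 6.6 (1) (p. 163), §13.9 and Lemma 13.10 (1) (pp. 229–230), §13.12 (p. 231: «a
non-zero-divisor μ of Λ such that μZ(f,T) ⊂ Z and Λ/μΛ is p-torsion free»), §13.14 (p. 234); [Washington1997] §7.2, §13.1
(`Λ/pΛ ≅ 𝔽_p⟦T⟧`); [MazurTateTeitelbaum1986Invent] §I.4 (4.2), §I.8; [Manin1972] Cor. 3.6; Delbourgo, *Elliptic curves and big
Galois representations* (2008) §2.5 (`(c² − c^{…}σ_c)(d² − d^{…}σ_d)`-multiplier of the `(c,d)`-zeta elements); tree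
`Kato2004/AdmissibleZetaClass.lean` (`katoMultiplier`), `Kato2004/ZetaClassOnRankLeOneBranch.lean` §6,
`Theorems/UniversalToricDescentSigmaEulerMuZero.lean` §1, `Theorems/ByReductionTypeAtTwoOrdKatoHalfAtTwoIsoZetaMultiplierMuTwo.lean`.
-/

set_option autoImplicit false
set_option linter.dupNamespace false

noncomputable section

open scoped Classical MatrixGroups ModularForm
open CongruenceSubgroup PowerSeries Field
open Literature.NumberTheory.EllipticCurves Literature.NumberTheory.EllipticCurves.Kato2004
  Literature.NumberTheory.EllipticCurves.IwasawaCharacter Literature.NumberTheory.GaloisRepresentations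
open Summit.BirchSwinnertonDyer.Rank1Residual.X11b.SigmaEulerMu

namespace Summit.BirchSwinnertonDyer.BirchSwinnertonDyer.Cruxes.EllipticUnitValueSevenOfGZK.MuFreeMultiplier

variable {p : ℕ} [hp : Fact p.Prime]

/-! ## §1 Images of `(1+T)^x` in `𝔽_p⟦T⟧ = Λ/pΛ` (any prime `p`) -/

section Images

/-- A power series over `𝔽_p` with constant coefficient `1` is non-zero. [folklore] -/
theorem ne_zero_of_constantCoeff_eq_one {F : PowerSeries (ZMod p)} (h : PowerSeries.constantCoeff F = 1) : F ≠ 0 := by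
  intro hF
  rw [hF, map_zero] at h
  exact zero_ne_one h

/-- The image of `(1+T)^x` in `𝔽_p⟦T⟧` has constant coefficient `1`. [cite: Washington1997, §7.2] -/
theorem constantCoeff_map_onePlusTPow (x : ℤ_[p]) :
    PowerSeries.constantCoeff
      (PowerSeries.map (PadicInt.toZMod (p := p)) (onePlusTPow p ℤ_[p] x : IwasawaAlgebra p)) = 1 := by
  rw [← PowerSeries.coeff_zero_eq_constantCoeff_apply, PowerSeries.coeff_map, val_onePlusTPow,
    PowerSeries.coeff_zero_eq_constantCoeff_apply, PowerSeries.binomialSeries_constantCoeff, map_one]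

/-- **`(1+T)^x ≢ 1 (mod p)` for `x ≠ 0`**, read in `𝔽_p⟦T⟧` (the tree's Lucas-free lemma
`SigmaEulerMu.not_C_p_dvd_onePlusTPow_sub_one`). [cite: Washington1997, §7.2 and §13.1] -/
theorem map_onePlusTPow_ne_one {x : ℤ_[p]} (hx : x ≠ 0) :
    PowerSeries.map (PadicInt.toZMod (p := p)) (onePlusTPow p ℤ_[p] x : IwasawaAlgebra p) ≠ 1 := by
  intro h
  apply not_C_p_dvd_onePlusTPow_sub_one (p := p) hx
  rw [C_p_dvd_iff_map_toZMod_eq_zero, map_sub, map_one, h, sub_self]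

/-- `(p : Λ) = C p`: the natural-number cast and the constant agree, so `(p : Λ) ∣ F ↔ C p ∣ F`. [folklore] -/
theorem natCast_dvd_iff_C_dvd (F : IwasawaAlgebra p) :
    (p : IwasawaAlgebra p) ∣ F ↔ (PowerSeries.C (p : ℤ_[p]) : IwasawaAlgebra p) ∣ F := by
  rw [map_natCast]

end Images

/-! ## §2 The three factor lemmas in the domain `𝔽_p⟦T⟧` -/

section Factors

/-- **Linear factor**: `d̄ − v ≠ 0` in `𝔽_p⟦T⟧` for `v` with constant coefficient `1` and `v ≠ 1` (if `v = d̄` is a constant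
with constant coefficient `1` then `v = 1`). [cite: Kato2004Asterisque, §13.9 (p. 229)] [cite: Washington1997, §7.2] -/
theorem linearFactor_ne_zero {v : PowerSeries (ZMod p)} (hv0 : PowerSeries.constantCoeff v = 1) (hv : v ≠ 1) (d : ℤ) :
    (d : PowerSeries (ZMod p)) - v ≠ 0 := by
  intro h
  have hvd : v = (d : PowerSeries (ZMod p)) := (sub_eq_zero.mp h).symm
  have hd1 : ((d : ℤ) : ZMod p) = 1 := by
    have h' := congrArg PowerSeries.constantCoeff hvd
    rwa [hv0, map_intCast, eq_comm] at h'
  apply hv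
  rw [hvd, ← map_intCast (PowerSeries.C (R := ZMod p)) d, hd1, map_one]

/-- **Two-term factor**: `c̄ n̄₁ − n̄₂ u ≠ 0` in `𝔽_p⟦T⟧` for `u` with constant coefficient `1`, `u ≠ 1`, `c̄ ≠ 0`, unless
`n̄₁ = n̄₂ = 0`: constant coefficients give `n̄₂ = c̄ n̄₁`, then `n̄₂ (u − 1) = 0` in a domain.
[cite: Kato2004Asterisque, Lemma 13.10 (1) (p. 230)] [cite: Washington1997, §7.2, §13.1] -/
theorem twoTermFactor_ne_zero {u : PowerSeries (ZMod p)} (hu0 : PowerSeries.constantCoeff u = 1) (hu : u ≠ 1)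
    {c n₁ n₂ : ℤ} (hc : ((c : ℤ) : ZMod p) ≠ 0) (hn : ¬ (((n₁ : ℤ) : ZMod p) = 0 ∧ ((n₂ : ℤ) : ZMod p) = 0)) :
    (c : PowerSeries (ZMod p)) * (n₁ : PowerSeries (ZMod p)) - (n₂ : PowerSeries (ZMod p)) * u ≠ 0 := by
  intro h
  have heq : (n₂ : PowerSeries (ZMod p)) * u = (c : PowerSeries (ZMod p)) * (n₁ : PowerSeries (ZMod p)) :=
    (sub_eq_zero.mp h).symm
  -- constant coefficients: `n̄₂ = c̄ n̄₁`
  have h0 : ((n₂ : ℤ) : ZMod p) = ((c : ℤ) : ZMod p) * ((n₁ : ℤ) : ZMod p) := by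
    have h' := congrArg PowerSeries.constantCoeff heq
    rwa [map_mul, map_mul, map_intCast, map_intCast, map_intCast, hu0, mul_one] at h'
  by_cases hn₂ : ((n₂ : ℤ) : ZMod p) = 0
  · -- then `c̄ n̄₁ = 0`, so `n̄₁ = 0`: excluded
    have hn₁ : ((n₁ : ℤ) : ZMod p) = 0 := by
      rw [hn₂, eq_comm, mul_eq_zero] at h0
      exact h0.resolve_left hc
    exact hn ⟨hn₁, hn₂⟩
  · -- `n̄₂ u = n̄₂`, so `u = 1`
    have hC : (n₂ : PowerSeries (ZMod p)) * u = (n₂ : PowerSeries (ZMod p)) := by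
      rw [heq, ← map_intCast (PowerSeries.C (R := ZMod p)) c, ← map_intCast (PowerSeries.C (R := ZMod p)) n₁,
        ← map_intCast (PowerSeries.C (R := ZMod p)) n₂, ← map_mul, ← h0]
    have hn₂C : (n₂ : PowerSeries (ZMod p)) ≠ 0 := by
      rw [← map_intCast (PowerSeries.C (R := ZMod p)) n₂]
      intro h0'
      apply hn₂
      have := congrArg PowerSeries.constantCoeff h0'
      rwa [PowerSeries.constantCoeff_C, map_zero] at this
    apply hu
    have h1 : (n₂ : PowerSeries (ZMod p)) * (u - 1) = 0 := by rw [mul_sub, mul_one, hC, sub_self]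
    exact sub_eq_zero.mp ((mul_eq_zero.mp h1).resolve_left hn₂C)

/-- **Kato's Euler factor mod `p` does not vanish**: in `𝔽_p⟦T⟧`, for `w` with constant coefficient `1`, `w ≠ 1` (the image of
`Ψ_ℓ`, `κ(σ_ℓ) ≠ 0`) and `ℓ̄ ≠ 0` (`ℓ ≠ p`): `ℓ̄² w² − (ā ℓ̄) w + ε̄ ℓ̄ ≠ 0` — with `w = 1 + δ`, `δ ≠ 0`, `δ ≡ 0 (mod T)`, it equals
`(ℓ̄² − āℓ̄ + ε̄ℓ̄) + δ((2ℓ̄² − āℓ̄) + ℓ̄²δ)`; reading constant coefficients twice leaves `ℓ̄² δ = 0`.  NO hypothesis on the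
Dirichlet coefficient `a_ℓ` or on `ε_ℓ`. [cite: Kato2004Asterisque, §13.9 (p. 229), Ex. 13.3 (p. 225)] [cite: Washington1997, §7.2] -/
theorem eulerFactor_ne_zero {w : PowerSeries (ZMod p)} (hw0 : PowerSeries.constantCoeff w = 1) (hw : w ≠ 1)
    {ℓ : ℕ} (hℓ : ((ℓ : ℕ) : ZMod p) ≠ 0) (a e : ℤ) :
    ((ℓ ^ 2 : ℕ) : PowerSeries (ZMod p)) * w ^ 2 - ((a * ℓ : ℤ) : PowerSeries (ZMod p)) * w +
      ((e * ℓ : ℤ) : PowerSeries (ZMod p)) ≠ 0 := by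
  set δ : PowerSeries (ZMod p) := w - 1 with hδ
  have hδ0 : δ ≠ 0 := fun h => hw (sub_eq_zero.mp h)
  have hδc : PowerSeries.constantCoeff δ = 0 := by rw [hδ, map_sub, hw0, map_one, sub_self]
  have hw1 : w = 1 + δ := by rw [hδ]; ring
  -- name the three constants
  set L : PowerSeries (ZMod p) := PowerSeries.C (((ℓ : ℕ) : ZMod p) ^ 2) with hL
  set A : PowerSeries (ZMod p) := PowerSeries.C (((a : ℤ) : ZMod p) * ((ℓ : ℕ) : ZMod p)) with hA
  set B : PowerSeries (ZMod p) := PowerSeries.C (((e : ℤ) : ZMod p) * ((ℓ : ℕ) : ZMod p)) with hB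
  have hLc : ((ℓ ^ 2 : ℕ) : PowerSeries (ZMod p)) = L := by
    rw [hL, map_pow, map_natCast, Nat.cast_pow]
  have hAc : ((a * ℓ : ℤ) : PowerSeries (ZMod p)) = A := by
    rw [hA, map_mul, map_intCast, map_natCast]; push_cast; ring
  have hBc : ((e * ℓ : ℤ) : PowerSeries (ZMod p)) = B := by
    rw [hB, map_mul, map_intCast, map_natCast]; push_cast; ring
  rw [hLc, hAc, hBc, hw1]
  have hG : L * (1 + δ) ^ 2 - A * (1 + δ) + B = (L - A + B) + δ * ((2 * L - A) + L * δ) := by ring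
  rw [hG]
  intro h
  -- constant coefficients: `ℓ̄² − āℓ̄ + ε̄ℓ̄ = 0`
  have h0 : PowerSeries.constantCoeff (L - A + B) = 0 := by
    have h' := congrArg PowerSeries.constantCoeff h
    rwa [map_add, map_mul, hδc, zero_mul, add_zero, map_zero] at h'
  have hconst : L - A + B = 0 := by
    rw [hL, hA, hB, ← map_sub, ← map_add] at h0 ⊢
    rw [PowerSeries.constantCoeff_C] at h0
    rw [h0, map_zero]
  rw [hconst, zero_add] at h
  have h1 : (2 * L - A) + L * δ = 0 := (mul_eq_zero.mp h).resolve_left hδ0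
  -- constant coefficients again: `2ℓ̄² − āℓ̄ = 0`
  have h1c : PowerSeries.constantCoeff (2 * L - A) = 0 := by
    have h' := congrArg PowerSeries.constantCoeff h1
    rwa [map_add, map_mul, hδc, mul_zero, add_zero, map_zero] at h'
  have hlin : 2 * L - A = 0 := by
    rw [hL, hA, ← map_ofNat (PowerSeries.C (R := ZMod p)) 2, ← map_mul, ← map_sub] at h1c ⊢
    rw [PowerSeries.constantCoeff_C] at h1c
    rw [h1c, map_zero]
  rw [hlin, zero_add] at h1
  -- `ℓ̄² δ = 0` with `δ ≠ 0`: so `ℓ̄² = 0`, contradiction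
  have hL0 : L = 0 := (mul_eq_zero.mp h1).resolve_right hδ0
  have hℓ2 : ((ℓ : ℕ) : ZMod p) ^ 2 = 0 := by
    have h' := congrArg PowerSeries.constantCoeff hL0
    rwa [hL, PowerSeries.constantCoeff_C, map_zero] at h'
  exact hℓ (pow_eq_zero_iff (n := 2) two_ne_zero |>.mp hℓ2)

end Factors

/-! ## §3 `p ∤ M̃` in the semi-diagonal and diagonal gauges (any prime `p`; no hypothesis on `a_ℓ, ε_ℓ`) -/

section Multiplier

/-- **`p ∤ M̃` in the SEMI-DIAGONAL gauge `n₃ = n₁, n₄ = n₂` (`d′ = 1`).** For integers `c, d` prime to `p`, cusp coordinates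
with NOT (`p ∣ n₁` and `p ∣ n₂`), exponents `x, y ≠ 0` of `Ψ_c = (1+T)^x`, `Ψ_d = (1+T)^y`, and a finite set `E` of naturals
prime to `p` with exponents `e ℓ ≠ 0`: the four-cusp factor reduces in `𝔽_p⟦T⟧` to `c̄ d̄ (d̄ − v)(c̄ n̄₁ − n̄₂ u)` and each Euler
factor to `ℓ̄²w² − āℓ̄w + ε̄ℓ̄`, none of which vanishes (§2); so `C p ∤ katoMultiplier p c d n₁ n₂ n₁ n₂ …`.
[cite: Kato2004Asterisque, Thm. 6.6 (1) (p. 163), Lemma 13.10 (1) (p. 230), §13.12 (p. 231)] [cite: Washington1997, §13.1] -/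
theorem not_C_p_dvd_katoMultiplier_semidiag {c d : ℤ} (hc : ¬ (p : ℤ) ∣ c) (hd : ¬ (p : ℤ) ∣ d) {n₁ n₂ : ℤ}
    (hn : ¬ ((p : ℤ) ∣ n₁ ∧ (p : ℤ) ∣ n₂)) {x y : ℤ_[p]} (hx : x ≠ 0) (hy : y ≠ 0)
    (E : Finset ℕ) (aℓ εℓ : ℕ → ℤ) {e : ℕ → ℤ_[p]} (hE : ∀ ℓ ∈ E, ¬ (p ∣ ℓ) ∧ e ℓ ≠ 0) :
    ¬ (PowerSeries.C (p : ℤ_[p]) : IwasawaAlgebra p) ∣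
      katoMultiplier p c d n₁ n₂ n₁ n₂ (onePlusTPow p ℤ_[p] x : IwasawaAlgebra p)
        (onePlusTPow p ℤ_[p] y : IwasawaAlgebra p) E aℓ εℓ
        (fun ℓ => (onePlusTPow p ℤ_[p] (e ℓ) : IwasawaAlgebra p)) := by
  rw [C_p_dvd_iff_map_toZMod_eq_zero]
  have hcz : ((c : ℤ) : ZMod p) ≠ 0 := fun h => hc ((ZMod.intCast_zmod_eq_zero_iff_dvd c p).mp h)
  have hdz : ((d : ℤ) : ZMod p) ≠ 0 := fun h => hd ((ZMod.intCast_zmod_eq_zero_iff_dvd d p).mp h)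
  have hnz : ¬ (((n₁ : ℤ) : ZMod p) = 0 ∧ ((n₂ : ℤ) : ZMod p) = 0) := fun h =>
    hn ⟨(ZMod.intCast_zmod_eq_zero_iff_dvd n₁ p).mp h.1, (ZMod.intCast_zmod_eq_zero_iff_dvd n₂ p).mp h.2⟩
  have hcC : (c : PowerSeries (ZMod p)) ≠ 0 := by
    rw [← map_intCast (PowerSeries.C (R := ZMod p)) c]
    intro h; apply hcz
    have := congrArg PowerSeries.constantCoeff h
    rwa [PowerSeries.constantCoeff_C, map_zero] at this
  have hdC : (d : PowerSeries (ZMod p)) ≠ 0 := by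
    rw [← map_intCast (PowerSeries.C (R := ZMod p)) d]
    intro h; apply hdz
    have := congrArg PowerSeries.constantCoeff h
    rwa [PowerSeries.constantCoeff_C, map_zero] at this
  set u := PowerSeries.map (PadicInt.toZMod (p := p)) (onePlusTPow p ℤ_[p] x : IwasawaAlgebra p) with hu
  set v := PowerSeries.map (PadicInt.toZMod (p := p)) (onePlusTPow p ℤ_[p] y : IwasawaAlgebra p) with hv
  unfold katoMultiplier
  rw [map_mul]
  refine mul_ne_zero ?_ ?_
  · -- the four-cusp factor: `c̄ d̄ (d̄ − v)(c̄ n̄₁ − n̄₂ u)`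
    rw [map_add, map_sub, map_sub, map_mul, map_mul, map_mul, map_mul, map_intCast, map_intCast, map_intCast,
      map_intCast, ← hu, ← hv]
    have key : ((c ^ 2 * d ^ 2 * n₁ : ℤ) : PowerSeries (ZMod p)) - ((c * d ^ 2 * n₂ : ℤ) : PowerSeries (ZMod p)) * u -
        ((c ^ 2 * d * n₁ : ℤ) : PowerSeries (ZMod p)) * v + ((c * d * n₂ : ℤ) : PowerSeries (ZMod p)) * u * v =
        ((c : PowerSeries (ZMod p)) * (d : PowerSeries (ZMod p))) *
          (((d : PowerSeries (ZMod p)) - v) *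
            ((c : PowerSeries (ZMod p)) * (n₁ : PowerSeries (ZMod p)) - (n₂ : PowerSeries (ZMod p)) * u)) := by
      push_cast; ring
    rw [key]
    exact mul_ne_zero (mul_ne_zero hcC hdC)
      (mul_ne_zero (linearFactor_ne_zero (constantCoeff_map_onePlusTPow y) (map_onePlusTPow_ne_one hy) d)
        (twoTermFactor_ne_zero (constantCoeff_map_onePlusTPow x) (map_onePlusTPow_ne_one hx) hcz hnz))
  · -- each Euler factor: `ℓ̄² w² − ā ℓ̄ w + ε̄ ℓ̄`
    rw [map_prod, Finset.prod_ne_zero_iff]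
    intro ℓ hℓ
    obtain ⟨hpℓ, heℓ⟩ := hE ℓ hℓ
    have hℓz : ((ℓ : ℕ) : ZMod p) ≠ 0 := fun h => hpℓ ((ZMod.natCast_eq_zero_iff ℓ p).mp h)
    rw [map_add, map_sub, map_mul, map_mul, map_pow, map_natCast, map_intCast, map_intCast]
    exact eulerFactor_ne_zero (constantCoeff_map_onePlusTPow (e ℓ)) (map_onePlusTPow_ne_one heℓ) hℓz (aℓ ℓ) (εℓ ℓ)

/-- **`p ∤ M̃` in the DIAGONAL gauge `n₁ = n₂ = n₃ = n₄ = n`** (`c ≡ d₁ ≡ 1 (mod A)`, `d′ = 1`): the case `p ∤ n` of the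
semi-diagonal theorem; the four-cusp factor is `n·c d (c − Ψ_c)(d − Ψ_d)`.
[cite: Kato2004Asterisque, Lemma 13.10 (1) (p. 230), §13.12 (p. 231)] -/
theorem not_C_p_dvd_katoMultiplier_diag {c d : ℤ} (hc : ¬ (p : ℤ) ∣ c) (hd : ¬ (p : ℤ) ∣ d) {n : ℤ}
    (hn : ¬ (p : ℤ) ∣ n) {x y : ℤ_[p]} (hx : x ≠ 0) (hy : y ≠ 0)
    (E : Finset ℕ) (aℓ εℓ : ℕ → ℤ) {e : ℕ → ℤ_[p]} (hE : ∀ ℓ ∈ E, ¬ (p ∣ ℓ) ∧ e ℓ ≠ 0) :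
    ¬ (PowerSeries.C (p : ℤ_[p]) : IwasawaAlgebra p) ∣
      katoMultiplier p c d n n n n (onePlusTPow p ℤ_[p] x : IwasawaAlgebra p)
        (onePlusTPow p ℤ_[p] y : IwasawaAlgebra p) E aℓ εℓ
        (fun ℓ => (onePlusTPow p ℤ_[p] (e ℓ) : IwasawaAlgebra p)) :=
  not_C_p_dvd_katoMultiplier_semidiag hc hd (fun h => hn h.1) hx hy E aℓ εℓ hE

/-- Currency `M̃ ∉ (p) = IwasawaAlgebra.augIdealP p` (semi-diagonal gauge). [cite: Kato2004Asterisque, §13.12 (p. 231)] -/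
theorem katoMultiplier_semidiag_not_mem_augIdealP {c d : ℤ} (hc : ¬ (p : ℤ) ∣ c) (hd : ¬ (p : ℤ) ∣ d) {n₁ n₂ : ℤ}
    (hn : ¬ ((p : ℤ) ∣ n₁ ∧ (p : ℤ) ∣ n₂)) {x y : ℤ_[p]} (hx : x ≠ 0) (hy : y ≠ 0)
    (E : Finset ℕ) (aℓ εℓ : ℕ → ℤ) {e : ℕ → ℤ_[p]} (hE : ∀ ℓ ∈ E, ¬ (p ∣ ℓ) ∧ e ℓ ≠ 0) :
    katoMultiplier p c d n₁ n₂ n₁ n₂ (onePlusTPow p ℤ_[p] x : IwasawaAlgebra p)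
        (onePlusTPow p ℤ_[p] y : IwasawaAlgebra p) E aℓ εℓ
        (fun ℓ => (onePlusTPow p ℤ_[p] (e ℓ) : IwasawaAlgebra p)) ∉ IwasawaAlgebra.augIdealP p := by
  rw [IwasawaAlgebra.augIdealP, Ideal.mem_span_singleton]
  exact not_C_p_dvd_katoMultiplier_semidiag hc hd hn hx hy E aℓ εℓ hE

end Multiplier

/-! ## §4 Exponents from the cyclotomic tower, and the `Ψ`-keyed theorem in the letter of the body -/

section Cyclotomic

/-- **In the CYCLOTOMIC `ℤ_p`-extension, `σ` with `χ_cyc(σ) = c ∈ ℤ`, `c ≠ ±1`, has `κ(σ) ≠ 0`.**  `κ(σ) = 0` means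
`σ ∈ ker κ = χ_cyc⁻¹(μ(ℤ_p))` (`ZpExtension.IsCyclotomic`), so `c^m = 1` in `ℤ_p`, hence in `ℤ`, for some `m ≥ 1`: `c = ±1`.
[cite: Washington1997, §13.1 (p. 264)] [cite: GreenbergLNM1716, §1] -/
theorem toAdd_ne_zero_of_isCyclotomic {K : ZpExtension ℚ p} (hK : K.IsCyclotomic) {σ : absoluteGaloisGroup ℚ} {c : ℤ}
    (hσ : ((GaloisRep.cyclotomicCharacter ℚ p σ : ℤ_[p]ˣ) : ℤ_[p]) = c) (h1 : c ≠ 1) (h1' : c ≠ -1) :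
    (K σ).toAdd ≠ 0 := by
  intro h0
  have hker : σ ∈ K.kerSubgroup := by
    rw [ZpExtension.mem_kerSubgroup, ← ofAdd_toAdd (K σ), h0, ofAdd_zero]
  rw [hK, Subgroup.mem_comap, CommGroup.mem_torsion, isOfFinOrder_iff_pow_eq_one] at hker
  obtain ⟨m, hm, hpow⟩ := hker
  have hpow₁ : (GaloisRep.cyclotomicCharacter ℚ p σ : ℤ_[p]ˣ) ^ m = 1 := hpow
  have hpow' : ((GaloisRep.cyclotomicCharacter ℚ p σ : ℤ_[p]ˣ) : ℤ_[p]) ^ m = 1 := by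
    rw [← Units.val_pow_eq_pow_val, hpow₁, Units.val_one]
  rw [hσ] at hpow'
  have hcm : c ^ m = 1 := by exact_mod_cast hpow'
  rcases Int.isUnit_iff.mp (IsUnit.of_pow_eq_one hcm hm.ne') with h | h
  exacts [h1 h, h1' h]

/-- For a prime `ℓ ≠ p` and `σ` with `χ_cyc(σ) = ℓ` in the cyclotomic tower: `κ(σ) ≠ 0` (`ℓ ≠ ±1`).
[cite: Washington1997, §13.1 (p. 264)] -/
theorem toAdd_ne_zero_of_isCyclotomic_prime {K : ZpExtension ℚ p} (hK : K.IsCyclotomic) {σ : absoluteGaloisGroup ℚ}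
    {ℓ : ℕ} (hℓ : ℓ.Prime) (hσ : ((GaloisRep.cyclotomicCharacter ℚ p σ : ℤ_[p]ˣ) : ℤ_[p]) = ℓ) :
    (K σ).toAdd ≠ 0 := by
  refine toAdd_ne_zero_of_isCyclotomic hK (c := (ℓ : ℤ)) (by rw [hσ, Int.cast_natCast]) ?_ ?_
  · exact_mod_cast hℓ.ne_one
  · have : (0 : ℤ) ≤ (ℓ : ℤ) := Int.natCast_nonneg ℓ
    omega

/-- **The `Ψ`-KEYED theorem in the letter of the μ-free clause of `HasMuFreeRealisedZetaFamilyBody`** (semi-diagonal gauge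
`n₃ = n₁, n₄ = n₂`): for the cyclotomic `ℤ_p`-extension `K`, Galois elements with `χ_cyc(σ_c) = c`, `χ_cyc(σ_{d₁}) = d₁`,
`χ_cyc(σ_ℓ) = ℓ` on `A.primeFactors.erase p`, integers `c, d₁ ∉ pℤ ∪ {±1}`, and NOT (`p ∣ n₁ ∧ p ∣ n₂`):
`¬ (p : Λ) ∣ katoMultiplier p c d₁ n₁ n₂ n₁ n₂ Ψ(σ_c) Ψ(σ_{d₁}) (A.primeFactors.erase p) a_• ε_• Ψ(σ_•)` — for ANY `a_•, ε_•`.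
[cite: Kato2004Asterisque, Lemma 13.10 (1) (p. 230), §13.12 (p. 231)] [cite: Castella2018, §2.1–2.2 (pp. 4–5)] -/
theorem not_natCast_dvd_katoMultiplier_psi_of_isCyclotomic (K : ZpExtension ℚ p) (hK : K.IsCyclotomic)
    {c d₁ : ℤ} (hc : ¬ (p : ℤ) ∣ c) (hd : ¬ (p : ℤ) ∣ d₁) (hc1 : c ≠ 1) (hc1' : c ≠ -1) (hd1 : d₁ ≠ 1) (hd1' : d₁ ≠ -1)
    {n₁ n₂ : ℤ} (hn : ¬ ((p : ℤ) ∣ n₁ ∧ (p : ℤ) ∣ n₂))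
    {σc σd : absoluteGaloisGroup ℚ} {σℓ : ℕ → absoluteGaloisGroup ℚ}
    (hσc : ((GaloisRep.cyclotomicCharacter ℚ p σc : ℤ_[p]ˣ) : ℤ_[p]) = c)
    (hσd : ((GaloisRep.cyclotomicCharacter ℚ p σd : ℤ_[p]ˣ) : ℤ_[p]) = d₁) {A : ℕ}
    (hσℓ : ∀ ℓ ∈ A.primeFactors.erase p, ((GaloisRep.cyclotomicCharacter ℚ p (σℓ ℓ) : ℤ_[p]ˣ) : ℤ_[p]) = ℓ)
    (aℓ εℓ : ℕ → ℤ) :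
    ¬ ((p : IwasawaAlgebra p) ∣
      katoMultiplier p c d₁ n₁ n₂ n₁ n₂
        ((IwasawaCharacter.Psi p ℤ_[p] K σc : (PowerSeries ℤ_[p])ˣ) : IwasawaAlgebra p)
        ((IwasawaCharacter.Psi p ℤ_[p] K σd : (PowerSeries ℤ_[p])ˣ) : IwasawaAlgebra p)
        (A.primeFactors.erase p) aℓ εℓ
        (fun ℓ => ((IwasawaCharacter.Psi p ℤ_[p] K (σℓ ℓ) : (PowerSeries ℤ_[p])ˣ) : IwasawaAlgebra p))) := by
  rw [natCast_dvd_iff_C_dvd]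
  simp only [IwasawaCharacter.Psi_apply]
  refine not_C_p_dvd_katoMultiplier_semidiag hc hd hn (toAdd_ne_zero_of_isCyclotomic hK hσc hc1 hc1')
    (toAdd_ne_zero_of_isCyclotomic hK hσd hd1 hd1') (A.primeFactors.erase p) aℓ εℓ (e := fun ℓ => (K (σℓ ℓ)).toAdd) ?_
  intro ℓ hℓ
  have hℓp : ℓ ≠ p := Finset.ne_of_mem_erase hℓ
  have hℓprime : ℓ.Prime := Nat.prime_of_mem_primeFactors (Finset.mem_of_mem_erase hℓ)
  refine ⟨fun hdvd => hℓp ((Nat.prime_dvd_prime_iff_eq hp.out hℓprime).mp hdvd).symm, ?_⟩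
  exact toAdd_ne_zero_of_isCyclotomic_prime hK hℓprime (hσℓ ℓ hℓ)

end Cyclotomic

/-! ## §5 The symbol side: a `p`-primitive minus symbol exists, and the diagonal gauge is admissible -/

section Symbols

variable {N : ℕ} (f : CuspForm (Gamma0 N) 2)

/-- **Some minus symbol is `p`-PRIMITIVE in the Manin lattice.**  If the rational minus symbols `[r]⁻_f` generate `ℤ·q⁻`
(`0 < q⁻`; the body's clause `AddSubgroup.closure (Set.range (ratMinusSymbol f)) = AddSubgroup.zmultiples qm`), then some
`[a/A]⁻_f = n·q⁻` with `p ∤ n` (else every symbol lies in `ℤ·pq⁻ ⊊ ℤ·q⁻`). [cite: Manin1972, Thm. 1.6 and Cor. 3.6]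
[cite: MazurTateTeitelbaum1986Invent, §I.8] -/
theorem exists_ratMinusSymbol_not_dvd {qm : ℚ} (hqm : 0 < qm)
    (hspan : AddSubgroup.closure (Set.range (ratMinusSymbol f)) = AddSubgroup.zmultiples qm) :
    ∃ (a : ℤ) (A : ℕ) (n : ℤ), 0 < A ∧ ratMinusSymbol f ((a : ℚ) / A) = n * qm ∧ ¬ (p : ℤ) ∣ n := by
  by_contra H
  push Not at H
  -- every symbol lies in `ℤ · (p qm)`
  have hsub : Set.range (ratMinusSymbol f) ⊆ (AddSubgroup.zmultiples ((p : ℚ) * qm) : Set ℚ) := by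
    rintro _ ⟨r, rfl⟩
    have hmem : ratMinusSymbol f r ∈ AddSubgroup.zmultiples qm := by
      rw [← hspan]; exact AddSubgroup.subset_closure ⟨r, rfl⟩
    obtain ⟨k, hk⟩ := AddSubgroup.mem_zmultiples_iff.mp hmem
    have hr : ratMinusSymbol f ((r.num : ℚ) / r.den) = k * qm := by
      rw [Rat.num_div_den r, ← hk, zsmul_eq_mul]
    obtain ⟨k', hk'⟩ := H r.num r.den k r.den_pos hr
    refine AddSubgroup.mem_zmultiples_iff.mpr ⟨k', ?_⟩
    rw [← hk, hk', zsmul_eq_mul, zsmul_eq_mul]; push_cast; ring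
  have hle : AddSubgroup.zmultiples qm ≤ AddSubgroup.zmultiples ((p : ℚ) * qm) := by
    rw [← hspan]; exact (AddSubgroup.closure_le _).mpr hsub
  have hqmem : qm ∈ AddSubgroup.zmultiples ((p : ℚ) * qm) := hle (AddSubgroup.mem_zmultiples qm)
  obtain ⟨k, hk⟩ := AddSubgroup.mem_zmultiples_iff.mp hqmem
  rw [zsmul_eq_mul] at hk
  -- `k p qm = qm` with `qm ≠ 0`: `k p = 1` in `ℤ`, impossible for a prime `p`
  have hkp : (k : ℚ) * p = 1 := by
    have h := hk
    rw [← mul_assoc] at h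
    exact mul_right_cancel₀ hqm.ne' (by rw [h, one_mul])
  have hkp' : k * (p : ℤ) = 1 := by exact_mod_cast hkp
  have hdvd : (p : ℤ) ∣ 1 := ⟨k, by rw [mul_comm, hkp']⟩
  exact hp.out.ne_one (Nat.dvd_one.mp (by exact_mod_cast hdvd))

/-- In the gauge `c ≡ 1 (mod A)`: `[a c/A]⁻ = [a/A]⁻` (periodicity `ratMinusSymbol_add_intCast`).
[cite: MazurTateTeitelbaum1986Invent, §I.4 (4.2)] -/
theorem ratMinusSymbol_mul_div_of_modEq_one [NeZero N] {A : ℕ} (hA : 0 < A) {c : ℤ} (hc : (A : ℤ) ∣ c - 1) (a : ℤ) :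
    ratMinusSymbol f ((a * c : ℚ) / A) = ratMinusSymbol f ((a : ℚ) / A) := by
  obtain ⟨k, hk⟩ := hc
  have hA' : (A : ℚ) ≠ 0 := by exact_mod_cast hA.ne'
  have hc' : (c : ℚ) = 1 + (A : ℚ) * k := by
    have : (c : ℤ) = 1 + (A : ℤ) * k := by omega
    exact_mod_cast this
  have : ((a * c : ℚ) / A) = (a : ℚ) / A + ((a * k : ℤ) : ℚ) := by
    rw [hc', div_add' _ _ _ hA']
    push_cast
    congr 1
    ring
  rw [this, ratMinusSymbol_add_intCast]

/-- In the gauge `c ≡ 1 (mod A)`, `d′ = 1`: the rational four-cusp factor is `[a/A]⁻ · c d (c − 1)(d − 1)`.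
[cite: Kato2004Asterisque, Thm. 6.6 (1) (p. 163), Lemma 13.10 (1) (p. 230)] -/
theorem ratCuspFactor_diag [NeZero N] {A : ℕ} (hA : 0 < A) {c : ℤ} (hc : (A : ℤ) ∣ c - 1) (d a : ℤ) :
    ratCuspFactor f true c d a A 1 =
      ratMinusSymbol f ((a : ℚ) / A) * ((c : ℚ) * d * (c - 1) * (d - 1)) := by
  have h2 := ratMinusSymbol_mul_div_of_modEq_one f hA hc a
  have h3 : ratMinusSymbol f ((a * (1 : ℤ) : ℚ) / A) = ratMinusSymbol f ((a : ℚ) / A) := by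
    rw [Int.cast_one, mul_one]
  have h4 : ratMinusSymbol f ((a * c * (1 : ℤ) : ℚ) / A) = ratMinusSymbol f ((a : ℚ) / A) := by
    rw [Int.cast_one, mul_one]; exact h2
  simp only [ratCuspFactor, ↓reduceIte]
  rw [h2, h3, h4]
  ring

/-- **ADMISSIBLE DIAGONAL-GAUGE PARAMETERS.**  For a prime `p`, a level `N ≠ 0`, a form `f` whose minus symbols generate
`ℤ·q⁻` (`0 < q⁻`): the parameters `(c, d₁, a, A, d′) = (1 + 6pA, 1 + 6pNA, a, A, 1)` — with `[a/A]⁻ = n q⁻`, `p ∤ n` from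
`exists_ratMinusSymbol_not_dvd` — satisfy EVERY guard of clause (A3) of `HasMuFreeRealisedZetaFamilyBody` (`0 < A`,
`gcd(c, 6pA) = 1`, `gcd(d₁, 6pN) = 1`, `d₁ d′ ≡ 1 (mod A)`, `R⁻ = ratCuspFactor f true c d₁ a A d′ ≠ 0`), the four symbol
equations of clause (A5′) at ONE coordinate `n₁ = n₂ = n₃ = n₄ = n`, the hypotheses of §3–§4 (`p ∤ n`, `p ∤ c`, `p ∤ d₁`,
`c, d₁ ≠ ±1`), and the (C5) guard of `ZetaBody` at every `p`-power level (`gcd(c d₁, p^k A) = 1`; tame levels are prime to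
`c d₁` by `badPlaces`). [cite: Kato2004Asterisque, §13.9 (p. 229), Lemma 13.10 (1) (p. 230), §13.12 (p. 231)]
[cite: MazurTateTeitelbaum1986Invent, §I.4 (4.2), §I.8] -/
theorem exists_diagonalGauge [NeZero N] {qm : ℚ} (hqm : 0 < qm)
    (hspan : AddSubgroup.closure (Set.range (ratMinusSymbol f)) = AddSubgroup.zmultiples qm) :
    ∃ (c d₁ a : ℤ) (A : ℕ) (d' : ℤ) (n : ℤ),
      0 < A ∧ Int.gcd c (6 * p * A) = 1 ∧ Int.gcd d₁ (6 * p * N) = 1 ∧ (d₁ : ℤ) * d' ≡ 1 [ZMOD (A : ℤ)] ∧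
      ratCuspFactor f true c d₁ a A d' ≠ 0 ∧
      ratMinusSymbol f ((a : ℚ) / A) = n * qm ∧ ratMinusSymbol f ((a * c : ℚ) / A) = n * qm ∧
      ratMinusSymbol f ((a * d' : ℚ) / A) = n * qm ∧ ratMinusSymbol f ((a * c * d' : ℚ) / A) = n * qm ∧
      ¬ (p : ℤ) ∣ n ∧ ¬ (p : ℤ) ∣ c ∧ ¬ (p : ℤ) ∣ d₁ ∧ c ≠ 1 ∧ c ≠ -1 ∧ d₁ ≠ 1 ∧ d₁ ≠ -1 ∧
      (∀ k : ℕ, Int.gcd (c * d₁) (p ^ k * A) = 1) := by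
  obtain ⟨a, A, n, hA, hn, hpn⟩ := exists_ratMinusSymbol_not_dvd (p := p) f hqm hspan
  have hN : 0 < N := Nat.pos_of_ne_zero (NeZero.ne N)
  have hp1 : 1 < p := hp.out.one_lt
  set c : ℤ := 1 + 6 * p * A with hcdef
  set d₁ : ℤ := 1 + 6 * p * N * A with hddef
  have hpos : (0 : ℤ) < 6 * p * A := by positivity
  have hposd : (0 : ℤ) < 6 * p * N * A := by positivity
  have hcA : (A : ℤ) ∣ c - 1 := ⟨6 * p, by rw [hcdef]; ring⟩
  have hpc : ¬ (p : ℤ) ∣ c := by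
    rw [hcdef, dvd_add_left (⟨6 * A, by ring⟩ : (p : ℤ) ∣ 6 * p * A)]
    intro h
    exact hp.out.ne_one (Nat.dvd_one.mp (by exact_mod_cast h))
  have hpd : ¬ (p : ℤ) ∣ d₁ := by
    rw [hddef, dvd_add_left (⟨6 * N * A, by ring⟩ : (p : ℤ) ∣ 6 * p * N * A)]
    intro h
    exact hp.out.ne_one (Nat.dvd_one.mp (by exact_mod_cast h))
  have hn0 : n ≠ 0 := by rintro rfl; exact hpn (dvd_zero _)
  have h₁ : ratMinusSymbol f ((a : ℚ) / A) = n * qm := hn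
  have h₂ : ratMinusSymbol f ((a * c : ℚ) / A) = n * qm := by
    rw [ratMinusSymbol_mul_div_of_modEq_one f hA hcA a, h₁]
  -- the (C5) guard of `ZetaBody` at every `p`-power level: `gcd(c d₁, p^k A) = 1`
  have hC5 : ∀ k : ℕ, Int.gcd (c * d₁) (p ^ k * A) = 1 := by
    intro k
    have hcp : IsCoprime c (p : ℤ) := ⟨1, -(6 * A), by rw [hcdef]; ring⟩
    have hcA' : IsCoprime c (A : ℤ) := ⟨1, -(6 * p), by rw [hcdef]; ring⟩
    have hdp : IsCoprime d₁ (p : ℤ) := ⟨1, -(6 * N * A), by rw [hddef]; ring⟩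
    have hdA : IsCoprime d₁ (A : ℤ) := ⟨1, -(6 * p * N), by rw [hddef]; ring⟩
    exact Int.isCoprime_iff_gcd_eq_one.mp
      (IsCoprime.mul_left (hcp.pow_right.mul_right hcA') (hdp.pow_right.mul_right hdA))
  refine ⟨c, d₁, a, A, 1, n, hA, ?_, ?_, ?_, ?_, h₁, h₂, ?_, ?_, hpn, hpc, hpd, ?_, ?_, ?_, ?_, hC5⟩
  · -- `gcd(1 + 6pA, 6pA) = 1`
    exact Int.isCoprime_iff_gcd_eq_one.mp ⟨1, -1, by rw [hcdef]; ring⟩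
  · -- `gcd(1 + 6pNA, 6pN) = 1`
    exact Int.isCoprime_iff_gcd_eq_one.mp ⟨1, -(A : ℤ), by rw [hddef]; ring⟩
  · -- `d₁ · 1 ≡ 1 (mod A)`
    exact Int.modEq_iff_dvd.mpr ⟨-(6 * p * N), by rw [hddef]; ring⟩
  · -- `R⁻ ≠ 0`
    rw [ratCuspFactor_diag f hA hcA d₁ a, h₁]
    have hc0 : (c : ℚ) ≠ 0 := by exact_mod_cast (show c ≠ 0 by omega)
    have hd0 : (d₁ : ℚ) ≠ 0 := by exact_mod_cast (show d₁ ≠ 0 by omega)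
    have hc1 : (c : ℚ) - 1 ≠ 0 := by
      have : ((c - 1 : ℤ) : ℚ) ≠ 0 := by exact_mod_cast (show c - 1 ≠ 0 by omega)
      push_cast at this; exact this
    have hd1 : (d₁ : ℚ) - 1 ≠ 0 := by
      have : ((d₁ - 1 : ℤ) : ℚ) ≠ 0 := by exact_mod_cast (show d₁ - 1 ≠ 0 by omega)
      push_cast at this; exact this
    have hnq : (n : ℚ) * qm ≠ 0 := mul_ne_zero (by exact_mod_cast hn0) hqm.ne'
    exact mul_ne_zero hnq (mul_ne_zero (mul_ne_zero (mul_ne_zero hc0 hd0) hc1) hd1)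
  · -- `[a d′/A]⁻` with `d′ = 1`
    rw [Int.cast_one, mul_one, h₁]
  · -- `[a c d′/A]⁻` with `d′ = 1`
    rw [Int.cast_one, mul_one, h₂]
  · omega
  · omega
  · omega
  · omega

end Symbols

/-! ## §6 The μ-free conjunct of the body in the diagonal gauge -/

section Conjunct

/-- **The μ-FREE CONJUNCT of `HasMuFreeRealisedZetaFamilyBody` in the diagonal gauge, VERBATIM shape** (`n₁ n₁ n₁ n₁`, `E =
A.primeFactors.erase p`, `Ψ_b = Psi p ℤ_p K σ_b`, the Dirichlet data `fun ℓ => W.LFunction ℓ`, `fun ℓ => if ℓ ∣ N then 0 else 1`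
being two instances of the arbitrary `aℓ εℓ`): for the cyclotomic `K` and parameters as in `exists_diagonalGauge`.  So the (E2)
prover who realises the family (clauses (A0)–(A4), the period clause and `0 ≤ e`) at these parameters gets the μ-free clause for
free. [cite: Kato2004Asterisque, §13.12 (p. 231), §13.14 (p. 234)] -/
theorem muFree_conjunct_of_diagonalGauge (K : ZpExtension ℚ p) (hK : K.IsCyclotomic)
    {c d₁ n : ℤ} (hc : ¬ (p : ℤ) ∣ c) (hd : ¬ (p : ℤ) ∣ d₁) (hc1 : c ≠ 1) (hc1' : c ≠ -1) (hd1 : d₁ ≠ 1) (hd1' : d₁ ≠ -1)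
    (hn : ¬ (p : ℤ) ∣ n) {σc σd : absoluteGaloisGroup ℚ} {σℓ : ℕ → absoluteGaloisGroup ℚ}
    (hσc : ((GaloisRep.cyclotomicCharacter ℚ p σc : ℤ_[p]ˣ) : ℤ_[p]) = c)
    (hσd : ((GaloisRep.cyclotomicCharacter ℚ p σd : ℤ_[p]ˣ) : ℤ_[p]) = d₁) {A : ℕ}
    (hσℓ : ∀ ℓ ∈ A.primeFactors.erase p, ((GaloisRep.cyclotomicCharacter ℚ p (σℓ ℓ) : ℤ_[p]ˣ) : ℤ_[p]) = ℓ)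
    (aℓ εℓ : ℕ → ℤ) :
    ¬ ((p : IwasawaAlgebra p) ∣
      katoMultiplier p c d₁ n n n n
        ((IwasawaCharacter.Psi p ℤ_[p] K σc : (PowerSeries ℤ_[p])ˣ) : IwasawaAlgebra p)
        ((IwasawaCharacter.Psi p ℤ_[p] K σd : (PowerSeries ℤ_[p])ˣ) : IwasawaAlgebra p)
        (A.primeFactors.erase p) aℓ εℓ
        (fun ℓ => ((IwasawaCharacter.Psi p ℤ_[p] K (σℓ ℓ) : (PowerSeries ℤ_[p])ˣ) : IwasawaAlgebra p))) :=
  not_natCast_dvd_katoMultiplier_psi_of_isCyclotomic K hK hc hd hc1 hc1' hd1 hd1' (fun h => hn h.1) hσc hσd hσℓ aℓ εℓ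

/-- **μ-free ⟺ `Λ/M̃Λ` is `p`-torsion-free** (the printed form of §13.12's requirement on `μ`): in `Λ = ℤ_p⟦T⟧`, `p` prime,
`p ∤ M` implies `M ∣ p·x → M ∣ x`. [cite: Kato2004Asterisque, §13.12 (p. 231, «Λ/μΛ is p-torsion free»)] [cite: Washington1997, §13.1] -/
theorem dvd_of_dvd_natCast_mul {M x : IwasawaAlgebra p} (hM : ¬ (p : IwasawaAlgebra p) ∣ M)
    (h : M ∣ (p : IwasawaAlgebra p) * x) : M ∣ x := by
  have hprime := prime_natCast_iwasawaAlgebra p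
  obtain ⟨y, hy⟩ := h
  -- `p ∣ M y` and `p ∤ M`, so `p ∣ y`
  have hpy : (p : IwasawaAlgebra p) ∣ y := by
    have : (p : IwasawaAlgebra p) ∣ M * y := ⟨x, by rw [← hy]⟩
    exact (hprime.dvd_or_dvd this).resolve_left hM
  obtain ⟨z, rfl⟩ := hpy
  refine ⟨z, ?_⟩
  have hp0 : (p : IwasawaAlgebra p) ≠ 0 := hprime.ne_zero
  apply mul_left_cancel₀ hp0
  rw [hy]; ring

end Conjunct

end Summit.BirchSwinnertonDyer.BirchSwinnertonDyer.Cruxes.EllipticUnitValueSevenOfGZK.MuFreeMultiplier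

end
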